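import Summits.CriticalPhenomena.PercolationContinuityZ3.Theorems.PercNearOneGluingNoHeavyPcintKernNFZ5B7Defs
import Summits.CriticalPhenomena.PercolationContinuityZ3.Theorems.PercNearOneGluingNoHeavyPcintWinKernelTree
import HarnessLib

/-!
# PCINT lane, kernel check 4/4 of the B3r window certificate `d = 5`, memory 7 (6-step windows; 1538 first-use normal forms of 1000000 codes): normal-form codes in `[524020, 1000000)`

Cell `prim-pcint`, seat `prim-pcint-2` (gen 2).  Collatz–Wielandt rows `10^5 · row ≤ 99999 · DEN · v` on the 255 normal-form codes in
`[524020, 1000000)` (`WinK.nfCodesIn`), by `decide +kernel` in blocks of at most `48` rows (`WinK.allB`, natural-number arithmetic only;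
`maxHeartbeats 0`) — table values read from the search tree `WinK.KT.ofListF 11 tbl` (`…PcintWinKernelTree`; check 1/4,
`…KernNFZ5B7Check1`, covers `[0, 276420)` with the linear table).  Does NOT build on p205010.
-/

namespace Summit.CriticalPhenomena.PercolationContinuityZ3.Theorems.Pcint.NFZ5B7

set_option maxHeartbeats 0 in
/-- The 48 rows with normal-form code in `[524020, 543120)` hold. [folklore] -/
theorem chk_524020_543120 : (WinK.nfCodesIn 5 6 524020 543120).all (WinK.rowOKBT 5 5 1145 10066 9935 99999 (WinK.KT.ofListF 11 tbl) 72351) = true :=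
  WinK.all_of_allB (fuel := 20) (by decide +kernel)

set_option maxHeartbeats 0 in
/-- The 48 rows with normal-form code in `[543120, 604120)` hold. [folklore] -/
theorem chk_543120_604120 : (WinK.nfCodesIn 5 6 543120 604120).all (WinK.rowOKBT 5 5 1145 10066 9935 99999 (WinK.KT.ofListF 11 tbl) 72351) = true :=
  WinK.all_of_allB (fuel := 20) (by decide +kernel)

set_option maxHeartbeats 0 in
/-- The 48 rows with normal-form code in `[604120, 640120)` hold. [folklore] -/
theorem chk_604120_640120 : (WinK.nfCodesIn 5 6 604120 640120).all (WinK.rowOKBT 5 5 1145 10066 9935 99999 (WinK.KT.ofListF 11 tbl) 72351) = true :=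
  WinK.all_of_allB (fuel := 20) (by decide +kernel)

set_option maxHeartbeats 0 in
/-- The 48 rows with normal-form code in `[640120, 654220)` hold. [folklore] -/
theorem chk_640120_654220 : (WinK.nfCodesIn 5 6 640120 654220).all (WinK.rowOKBT 5 5 1145 10066 9935 99999 (WinK.KT.ofListF 11 tbl) 72351) = true :=
  WinK.all_of_allB (fuel := 20) (by decide +kernel)

set_option maxHeartbeats 0 in
/-- The 48 rows with normal-form code in `[654220, 861420)` hold. [folklore] -/
theorem chk_654220_861420 : (WinK.nfCodesIn 5 6 654220 861420).all (WinK.rowOKBT 5 5 1145 10066 9935 99999 (WinK.KT.ofListF 11 tbl) 72351) = true :=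
  WinK.all_of_allB (fuel := 20) (by decide +kernel)

set_option maxHeartbeats 0 in
/-- The 15 rows with normal-form code in `[861420, 1000000)` hold. [folklore] -/
theorem chk_861420_1000000 : (WinK.nfCodesIn 5 6 861420 1000000).all (WinK.rowOKBT 5 5 1145 10066 9935 99999 (WinK.KT.ofListF 11 tbl) 72351) = true :=
  WinK.all_of_allB (fuel := 20) (by decide +kernel)

/-- The rows with normal-form code in `[524020, 1000000)` hold. [folklore] -/
theorem chkFile_4 : (WinK.nfCodesIn 5 6 524020 1000000).all (WinK.rowOKBT 5 5 1145 10066 9935 99999 (WinK.KT.ofListF 11 tbl) 72351) = true :=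
  WinK.all_nfCodesIn_append (WinK.all_nfCodesIn_append (WinK.all_nfCodesIn_append (WinK.all_nfCodesIn_append (WinK.all_nfCodesIn_append chk_524020_543120 chk_543120_604120) chk_604120_640120) chk_640120_654220) chk_654220_861420) chk_861420_1000000

end Summit.CriticalPhenomena.PercolationContinuityZ3.Theorems.Pcint.NFZ5B7
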